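import Literature.AlgebraicGeometry.Motives.HodgeLieWeightOneLeviCornerRank
import Literature.AlgebraicGeometry.Motives.HodgeThetaSubalgebraLeviCornerSkeleton
import HarnessLib

/-!
# Weight one, rank twelve: a minimal raising tripotent of rank `3` is impossible — THIN CORNERS, the `ℂ³ ⊗ ℂ²` skeleton and an
# invariant plane; hence `End_Hdg = ℚ`, `dim V = 12` ⟹ `Lie Hg ⊗ ℂ = 𝔰𝔭₁₂`
# (Moonen–Zarhin 1999 (2.3)–(2.5), (3.1); Deligne I §3; classification-free)

Family `hodge`, layer `Literature/AlgebraicGeometry/Motives`; THEOREMS ONLY (no definition, no named fact; D-0026).  Written for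
the cell `pub-hodgeav-hg6` (LADDER-HodgeAV row 2, TABLE X row 1 `g6.I(1)`: the `r = 3` RETURN LEG of the rank-twelve programme,
brick R4, eng-2 lineage g5; honest framing: HC / HC_AV / HC_CM NOT proved — unconditional Hodge–Lie linear algebra).

THE ARGUMENT (`WeightOnePeirce.false_of_minimal_rank_three`).  `H` effective polarized of weight one, `End_Hdg = ℚ`, `dim V = 12`,
`𝔥_ℂ` simple, `B` a minimal raising tripotent of rank `3` (`B B̄ B = tB`).  On `P = V^{1,0} ≅ ℂ⁶` let `𝔏 = 𝔥⁰|_P` (N12: irreducible,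
unital, bracket-closed) and `E′ = t⁻¹BB̄|_P ∈ 𝔏`, an idempotent with `dim range E′ = dim ker E′ = 3`.  CORNERS: the upper corner
`E′𝔏(1−E′)` is thin (`WeightOnePeirce.upperCorner_finrank_le_one`, R1), hence has no rank-one element (`LeviCorner.false_of_rankOne`,
R2), hence is a line `ℂN₀` with `N₀ : ker E′ ≅ range E′` (`LeviCorner.exists_generator`, R3).  With the Levi lift `Z_N` of `N₀` the
compression `C′ = Z_N B̄ Z_N ∈ 𝔥⁻` makes `ψ_ℂ(C′·,·)` non-degenerate on `ker E′`, so the lower corner is thin too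
(`WeightOnePeirce.corner_finrank_le_one`) and is a line `ℂM₀`, `M₀ : range E′ ≅ ker E′`.  SKELETON (R3b): `xB̄|_P ∈ ℂE′ + ℂM₀`,
`xC′|_P ∈ ℂ(1−E′) + ℂN₀`, `Bz|_P ∈ ℂE′ + ℂN₀`, `B′z|_P ∈ ℂ(1−E′) + ℂM₀` (`B′ = Z_M B Z_M`) for raising `x`, lowering `z`.
INVARIANT PLANE: for an eigenvector `u` of `N₀M₀` in `range E′` and `m = M₀u`, every `x z` (`x` raising, `z` lowering) maps `u` and
`m` into `ℂu + ℂm` (through `ℂB̄u + ℂC′m ⊆ Q`, where `q ∈ Q` with `Bq = B′q = 0` vanishes); by N15 so does `𝔥⁰`, and the plane is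
`𝔏`-stable — contradicting Levi irreducibility (`dim P = 6`).

* §1 **`WeightOnePeirce.exists_smulRight_of_finrank_range_eq_one`** (a rank-one operator is `u ⊗ φ`).
* §2 **`WeightOnePeirce.false_of_minimal_rank_three`** — THE `r = 3` KILL.
* §3 **`mem_hodgeLieC_of_skew_rankTwelve`** — `End_Hdg = ℚ`, `dim_ℚ V = 12` ⟹ every `ψ_ℂ`-skew operator lies in `Lie Hg ⊗ ℂ`
  (`= RankTwelveTarget`: `Hg = Sp₁₂` for the general polarized weight-one Hodge structure of rank `12` with trivial endomorphisms).

## References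

* [MoonenZarhin1999LowDim] B. Moonen, Yu. Zarhin, *Hodge classes on abelian varieties of low dimension*, Math. Ann. 315 (1999),
  §2 (2.3)–(2.5), §3 (3.1).
* [Deligne1982HodgeCycles] P. Deligne, *Hodge cycles on abelian varieties*, LNM 900 (1982), I §3 (Prop. 3.4, 3.6).
* [Ribet1983] K. Ribet, *Hodge classes on certain types of abelian varieties*, Amer. J. Math. 105 (1983), Thm. 3.
-/

noncomputable section

open scoped TensorProduct

open Module

namespace Literature.AlgebraicGeometry.Motives

namespace HodgeStructure

universe u

/-! ## §1 Rank-one operators -/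

/-- **A rank-one operator is `u ⊗ φ`:** if `dim range N = 1` then `N = φ.smulRight u` with `u ≠ 0`, `φ ≠ 0`.
[cite: MoonenZarhin1999LowDim, §2 (2.3)] -/
theorem WeightOnePeirce.exists_smulRight_of_finrank_range_eq_one {W : Type*} [AddCommGroup W] [Module ℂ W]
    {N : Module.End ℂ W} (hN : Module.finrank ℂ (LinearMap.range N) = 1) :
    ∃ (u : W) (φ : Module.Dual ℂ W), u ≠ 0 ∧ φ ≠ 0 ∧ N = φ.smulRight u := by
  classical
  obtain ⟨u₀, hu₀0, hu₀⟩ := (finrank_eq_one_iff' (K := ℂ) (V := ↥(LinearMap.range N))).1 hN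
  set u : W := (u₀ : W) with hudef
  have hu0 : u ≠ 0 := fun h => hu₀0 (Subtype.ext h)
  -- the coefficient functional
  have hcoef : ∀ w, ∃ c : ℂ, N w = c • u := fun w => by
    obtain ⟨c, hc⟩ := hu₀ ⟨N w, LinearMap.mem_range_self N w⟩
    exact ⟨c, by simpa [hudef] using (congrArg Subtype.val hc).symm⟩
  have hmem : ∀ w, N w ∈ (ℂ ∙ u) := fun w => by
    obtain ⟨c, hc⟩ := hcoef w
    rw [hc]
    exact Submodule.smul_mem _ _ (Submodule.mem_span_singleton_self u)
  let φ : Module.Dual ℂ W := (LinearEquiv.coord ℂ W u hu0).toLinearMap ∘ₗ N.codRestrict (ℂ ∙ u) hmem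
  have hφ : ∀ w, φ w • u = N w := fun w => by
    have h := LinearEquiv.coord_apply_smul ℂ W u hu0 ⟨N w, hmem w⟩
    exact h
  refine ⟨u, φ, hu0, fun h0 => ?_, LinearMap.ext fun w => by rw [LinearMap.smulRight_apply, hφ]⟩
  -- `φ = 0` would force `N = 0`
  have hN0 : N = 0 := LinearMap.ext fun w => by rw [← hφ, h0, LinearMap.zero_apply, zero_smul, LinearMap.zero_apply]
  rw [hN0, LinearMap.range_zero, finrank_bot] at hN
  exact zero_ne_one hN

variable {V : Type u} [AddCommGroup V] [Module ℚ V] [Module.Finite ℚ V] [HodgeTensorFacts.{u, u}] {n : ℤ}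

/-! ## §2 The `r = 3` kill -/

set_option maxHeartbeats 12800000 in
/-- **A minimal raising tripotent of rank `3` is impossible (rank twelve, `End_Hdg = ℚ`, `𝔥_ℂ` simple).**  See the module
docstring (thin corners; corner lines `N₀`, `M₀`; the compressions `C′ = Z_N B̄ Z_N`, `B′ = Z_M B Z_M`; the skeleton decompositions;
the invariant plane `ℂu + ℂM₀u` for an eigenvector `u` of `N₀M₀`).
[cite: MoonenZarhin1999LowDim, §2 (2.3)–(2.5), Thm. (2.7)] [cite: Deligne1982HodgeCycles, I §3 Prop. 3.4, Prop. 3.6]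
[cite: Ribet1983, Thm. 3] -/
theorem WeightOnePeirce.false_of_minimal_rank_three (H : HodgeStructure V n) (ψ : H.Polarization) (hn : n = 1)
    (heff : H.IsEffective) (hE : ∀ a ∈ H.endAlg, ∃ x : ℚ, a = x • (1 : Module.End ℚ V))
    (hV : Module.finrank ℚ V = 12)
    (hsimple : ∀ T : Submodule ℂ (Module.End ℂ (ℂ ⊗[ℚ] V)), T ≤ H.hodgeLieC → T ≠ ⊥ →
      (∀ Y ∈ H.hodgeLieC, ∀ t ∈ T, Y * t - t * Y ∈ T) → T = H.hodgeLieC)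
    {B C : Module.End ℂ (ℂ ⊗[ℚ] V)} (hB : B ∈ H.hodgeLieC) (hB0 : B ≠ 0) (hBP : ∀ p ∈ H.piece 1 0, B p = 0)
    (hBim : ∀ v, B v ∈ H.piece 1 0) (hC : ∀ v, C v = conj (B (conj v)))
    (hmin : ∀ B' ∈ H.hodgeLieC, B' ≠ 0 → (∀ p ∈ H.piece 1 0, B' p = 0) → (∀ v, B' v ∈ H.piece 1 0) →
      Module.finrank ℂ (LinearMap.range B) ≤ Module.finrank ℂ (LinearMap.range B'))
    (h3 : Module.finrank ℂ (LinearMap.range B) = 3) : False := by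
  classical
  obtain ⟨hbr, hskew, -, Θ, hΘ, hΘ𝔤⟩ := hodgeLie_standing H ψ
  have hspan : H.hodgeLieC = spanC H.hodgeLie := hodgeLieC_eq_spanC H
  have hΘC : Θ ∈ H.hodgeLieC := by rw [hspan]; exact hΘ𝔤
  have hbrC : ∀ Y ∈ H.hodgeLieC, ∀ Z ∈ H.hodgeLieC, Y * Z - Z * Y ∈ H.hodgeLieC := fun Y hY Z hZ => by
    rw [hspan] at hY hZ ⊢
    exact commutator_mem_spanC hbr hY hZ
  have hirr : ∀ U : Submodule ℂ (ℂ ⊗[ℚ] V), (∀ Z ∈ H.hodgeLieC, ∀ u ∈ U, Z u ∈ U) → U = ⊥ ∨ U = ⊤ :=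
    fun U hU => SymplecticTheta.eq_bot_or_top_of_stable H hn heff ψ hE H.hodgeLie hΘ hΘ𝔤 hskew
      fun X hX u hu => hU _ (by rw [hspan]; exact baseChange_mem_spanC hX) u hu
  have hC𝔊 : C ∈ H.hodgeLieC := by
    rw [hspan] at hB ⊢
    exact conjOp_mem_spanC hB hC
  obtain ⟨hP6, -⟩ := finrank_pieces_eq_of_weightOne H hn heff (m := 6) (by rw [hV]) hΘ
  obtain ⟨t, ht, hBCB⟩ :=
    WeightOneMinimalRaising.mul_conjOp_mul_eq_smul H ψ hn heff hΘ le_rfl hbrC hB hB0 hBP hBim hC hC𝔊 hmin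
  obtain ⟨hCBC, -⟩ := WeightOnePeirce.conjOp_mul_conjOp_mul hC ht hB0 hBCB
  have hnd := WeightOnePeirce.form_conjOp_nondegenerate_on_range H ψ hn heff hB hB0 hBP hBim hC hmin
  -- the Levi involution algebra `𝔏` (N12): we use only its membership description, closure, `1 ∈ 𝔏`, irreducibility
  obtain ⟨𝔏, -, -, -, hmem𝔏, h𝔏br, h𝔏one, h𝔏irr, -⟩ :=
    WeightOnePeirce.exists_leviInvolutionAlgebra H ψ hn heff hΘ le_rfl hbrC hΘC hirr hB hB0 hBP hBim hC hC𝔊 hmin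
  subst hn
  obtain ⟨hPmem, hQmem, hΘ10, hΘ01, hΘΘ⟩ := UnitaryTheta.theta_facts H rfl heff hΘ
  obtain ⟨hCQ, hCim, -, -⟩ := SymplecticThetaTen.conjOp_raise (P := H.piece 1 0) (Q := H.piece 0 1)
    (fun x hx => conj_mem_piece H hx) (fun x hx => conj_mem_piece H hx) hBP hBim hC
  set ω := ψ.form.baseChange ℂ with hω
  have hωnd : ω.Nondegenerate := by rw [hω]; exact ψ.nondegenerate_baseChange
  have hQQ : ∀ q ∈ H.piece 0 1, ∀ q' ∈ H.piece 0 1, ω q q' = 0 := fun q hq q' hq' =>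
    ψ.form_piece_piece (p := 0) (p' := 0) (by norm_num) (by simpa using hq) (by simpa using hq')
  have hvdec : ∀ v : ℂ ⊗[ℚ] V, (2 : ℂ)⁻¹ • (v + Θ v) + (2 : ℂ)⁻¹ • (v - Θ v) = v := fun v => by module
  have hskB : ∀ a b, ω (B a) b = -ω a (B b) := fun a b => by rw [hω]; exact formBaseChange_skew_of_mem_hodgeLieC ψ hB a b
  -- Levi lifts of the elements of `𝔏`, and restrictions of Levi-type products
  have hlift : ∀ A ∈ 𝔏, ∃ Z ∈ H.hodgeLieC, (∀ p : ↥(H.piece 1 0), Z (p : ℂ ⊗[ℚ] V) = ((A p : ↥(H.piece 1 0)) : ℂ ⊗[ℚ] V)) ∧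
      (∀ p ∈ H.piece 1 0, Z p ∈ H.piece 1 0) ∧ (∀ q ∈ H.piece 0 1, Z q ∈ H.piece 0 1) := by
    intro A hA
    obtain ⟨Z', hZ', hAZ'⟩ := (hmem𝔏 A).1 hA
    have hZ'P : ∀ p ∈ H.piece 1 0, Z' p ∈ H.piece 1 0 := fun p hp => by
      have h := (A ⟨p, hp⟩).2
      rw [hAZ' ⟨p, hp⟩] at h
      exact h
    obtain ⟨Z, hZ, hZZ', hZP, hZQ⟩ := LeviCompression.exists_levi_lift H ψ rfl heff hZ' hZ'P
    exact ⟨Z, hZ, fun p => by rw [hZZ' _ p.2]; exact (hAZ' p).symm, hZP, hZQ⟩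
  have hrestr : ∀ {Y : Module.End ℂ (ℂ ⊗[ℚ] V)} (hYP : ∀ p ∈ H.piece 1 0, Y p ∈ H.piece 1 0), (∃ Z ∈ H.hodgeLieC, ∀ p ∈ H.piece 1 0, Z p = Y p) →
      Y.restrict hYP ∈ 𝔏 := by
    intro Y hYP ⟨Z, hZ, hZY⟩
    exact (hmem𝔏 _).2 ⟨Z, hZ, fun p => by rw [LinearMap.coe_restrict_apply, hZY _ p.2]⟩
  -- the idempotent `E = t⁻¹ B C` and its restriction `E′` to `P`
  set E : Module.End ℂ (ℂ ⊗[ℚ] V) := t⁻¹ • (B * C) with hEdef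
  have hEv : ∀ v, E v = t⁻¹ • B (C v) := fun v => by rw [hEdef, LinearMap.smul_apply, Module.End.mul_apply]
  have hEP : ∀ v ∈ H.piece 1 0, E v ∈ H.piece 1 0 := fun v _ => by rw [hEv]; exact Submodule.smul_mem _ _ (hBim _)
  have hEB : ∀ w, E (B w) = B w := fun w => by
    rw [hEv, ← Module.End.mul_apply, ← Module.End.mul_apply, hBCB, LinearMap.smul_apply, smul_smul,
      inv_mul_cancel₀ ht, one_smul]
  have hErg : ∀ v, E v ∈ LinearMap.range B := fun v => by rw [hEv]; exact Submodule.smul_mem _ _ ⟨C v, rfl⟩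
  have hEEv : ∀ v, E (E v) = E v := fun v => by obtain ⟨w, hw⟩ := hErg v; rw [← hw, hEB]
  have hEker : ∀ p, E p = 0 → C p = 0 := fun p hp => by
    have h1 : B (C p) = 0 := by
      rw [hEv, smul_eq_zero] at hp
      exact hp.resolve_left (inv_ne_zero ht)
    have h2 : C (B (C p)) = t • C p := by
      rw [← Module.End.mul_apply, ← Module.End.mul_apply, hCBC, LinearMap.smul_apply]
    rw [h1, map_zero] at h2
    exact ((smul_eq_zero.1 h2.symm).resolve_left ht)
  have hEfix : ∀ v, E v = v → B (C v) = t • v := fun v hv => by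
    have h := congrArg (fun w => t • w) hv
    simp only [hEv, smul_smul, mul_inv_cancel₀ ht, one_smul] at h
    exact h
  have hCE : ∀ v, C (E v) = C v := fun v => by
    rw [hEv, map_smul, ← Module.End.mul_apply (f := C) (g := B), ← Module.End.mul_apply (f := C * B) (g := C), hCBC,
      LinearMap.smul_apply, smul_smul, inv_mul_cancel₀ ht, one_smul]
  set E' : Module.End ℂ ↥(H.piece 1 0) := E.restrict hEP with hE'def
  have hE'v : ∀ p : ↥(H.piece 1 0), ((E' p : ↥(H.piece 1 0)) : ℂ ⊗[ℚ] V) = E p := fun p => rfl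
  have hE'𝔏 : E' ∈ 𝔏 := hrestr hEP ⟨t⁻¹ • (B * C - C * B),
    Submodule.smul_mem _ _ (hbrC B hB C hC𝔊), fun p hp => by
      rw [LinearMap.smul_apply, LinearMap.sub_apply, Module.End.mul_apply, Module.End.mul_apply, hBP p hp, map_zero,
        sub_zero, hEv]⟩
  have hE'E' : E' * E' = E' := LinearMap.ext fun p => Subtype.ext (by
    rw [Module.End.mul_apply, hE'v, hE'v, hEEv])
  -- dimensions of `range E′` and `ker E′`
  have hmapR : (LinearMap.range E').map (H.piece 1 0).subtype = LinearMap.range B := by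
    apply le_antisymm
    · rintro _ ⟨y, ⟨p, rfl⟩, rfl⟩
      exact hErg _
    · rintro _ ⟨w, rfl⟩
      exact ⟨⟨B w, hBim w⟩, ⟨⟨B w, hBim w⟩, Subtype.ext (hEB w)⟩, rfl⟩
  have hfinR : Module.finrank ℂ (LinearMap.range E') = 3 := by
    rw [← Submodule.finrank_map_subtype_eq (H.piece 1 0) (LinearMap.range E'), hmapR, h3]
  have hfinK : Module.finrank ℂ (LinearMap.ker E') = 3 := by
    have h := LinearMap.finrank_range_add_finrank_ker E'
    have hP6' : Module.finrank ℂ ↥(H.piece 1 0) = 6 := hP6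
    omega
  -- images and ranks of lifts
  have hmapZ : ∀ {A : Module.End ℂ ↥(H.piece 1 0)} {Z : Module.End ℂ (ℂ ⊗[ℚ] V)},
      (∀ p : ↥(H.piece 1 0), Z (p : ℂ ⊗[ℚ] V) = ((A p : ↥(H.piece 1 0)) : ℂ ⊗[ℚ] V)) → (H.piece 1 0).map Z = (LinearMap.range A).map (H.piece 1 0).subtype := by
    intro A Z hZv
    apply le_antisymm
    · rintro _ ⟨p, hp, rfl⟩
      exact ⟨A ⟨p, hp⟩, ⟨⟨p, hp⟩, rfl⟩, (hZv ⟨p, hp⟩).symm⟩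
    · rintro _ ⟨y, ⟨p, rfl⟩, rfl⟩
      exact ⟨p, p.2, hZv p⟩
  have hfinZ : ∀ {A : Module.End ℂ ↥(H.piece 1 0)} {Z : Module.End ℂ (ℂ ⊗[ℚ] V)},
      (∀ p : ↥(H.piece 1 0), Z (p : ℂ ⊗[ℚ] V) = ((A p : ↥(H.piece 1 0)) : ℂ ⊗[ℚ] V)) →
      Module.finrank ℂ ((H.piece 1 0).map Z) = Module.finrank ℂ (LinearMap.range A) := by
    intro A Z hZv
    rw [hmapZ hZv, Submodule.finrank_map_subtype_eq]
  -- THIN UPPER CORNER (R1)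
  have hthinU : ∀ N ∈ 𝔏, E' * N = N → N * E' = 0 → Module.finrank ℂ (LinearMap.range N) ≤ 2 →
      Module.finrank ℂ (LinearMap.range N) ≤ 1 := by
    intro N hN hEN hNE hk
    obtain ⟨Z, hZ, hZv, hZP, hZQ⟩ := hlift N hN
    have hZB : ∀ w, Z (B w) = 0 := fun w => by
      have h1 : E' ⟨B w, hBim w⟩ = ⟨B w, hBim w⟩ := Subtype.ext (hEB w)
      have h2 : N ⟨B w, hBim w⟩ = 0 := by
        rw [← h1, ← Module.End.mul_apply, hNE, LinearMap.zero_apply]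
      rw [hZv ⟨B w, hBim w⟩, h2, Submodule.coe_zero]
    have hZU : ∀ p ∈ H.piece 1 0, Z p ∈ LinearMap.range B := fun p hp => by
      rw [hZv ⟨p, hp⟩, ← hEN, Module.End.mul_apply, hE'v]
      exact hErg _
    have hk' : Module.finrank ℂ ((H.piece 1 0).map Z) ≤ 2 := by rw [hfinZ hZv]; exact hk
    have h := WeightOnePeirce.upperCorner_finrank_le_one H ψ rfl heff hB hB0 hBP hBim hC hmin h3 hZ hZP hZQ hZB hZU hk'
    rwa [hfinZ hZv] at h
  -- no non-zero corner element of rank `≤ 2` (R2 + rank-one operators), for `E′` and for `1 − E′`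
  have hno1 : ∀ F : Module.End ℂ ↥(H.piece 1 0), F ∈ 𝔏 → F * F = F → 2 ≤ Module.finrank ℂ (LinearMap.range F) →
      2 ≤ Module.finrank ℂ (LinearMap.ker F) →
      (∀ N ∈ 𝔏, F * N = N → N * F = 0 → Module.finrank ℂ (LinearMap.range N) ≤ 2 →
        Module.finrank ℂ (LinearMap.range N) ≤ 1) →
      ∀ N ∈ 𝔏, F * N = N → N * F = 0 → Module.finrank ℂ (LinearMap.range N) ≤ 2 → N = 0 := by
    intro F hF hFF hFr hFk hthin N hN hFN hNF hk
    by_contra hN0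
    have h1 : Module.finrank ℂ (LinearMap.range N) = 1 := by
      have hle := hthin N hN hFN hNF hk
      have hne : Module.finrank ℂ (LinearMap.range N) ≠ 0 := fun h =>
        hN0 (LinearMap.range_eq_bot.1 (Submodule.finrank_eq_zero.1 h))
      omega
    obtain ⟨u, φ, hu, hφ, hNeq⟩ := WeightOnePeirce.exists_smulRight_of_finrank_range_eq_one h1
    obtain ⟨w₀, hw₀⟩ : ∃ w, φ w ≠ 0 := by
      by_contra h
      push Not at h
      exact hφ (LinearMap.ext h)
    have hFu : F u = u := by
      have h := congrArg (fun X : Module.End ℂ ↥(H.piece 1 0) => X w₀) hFN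
      simp only [Module.End.mul_apply, hNeq, LinearMap.smulRight_apply, map_smul] at h
      exact smul_right_injective _ hw₀ h
    have hφF : φ ∘ₗ F = 0 := by
      refine LinearMap.ext fun w => ?_
      have h := congrArg (fun X : Module.End ℂ ↥(H.piece 1 0) => X w) hNF
      simp only [Module.End.mul_apply, hNeq, LinearMap.smulRight_apply, LinearMap.zero_apply, smul_eq_zero] at h
      rw [LinearMap.comp_apply, LinearMap.zero_apply]
      exact h.resolve_right hu
    rw [hNeq] at hN
    exact LeviCorner.false_of_rankOne h𝔏br h𝔏one h𝔏irr hF hFF hFr hFk hthin hu hφ hN hFu hφF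
  have hno1U : ∀ N ∈ 𝔏, E' * N = N → N * E' = 0 → Module.finrank ℂ (LinearMap.range N) ≤ 2 → N = 0 :=
    hno1 E' hE'𝔏 hE'E' (by omega) (by omega) hthinU
  -- the upper corner line `ℂN₀` (R3) and the Levi lift `Z_N`
  obtain ⟨N₀, hN₀, hEN₀, hN₀E, hN₀0, hN₀inj, hN₀line⟩ :=
    LeviCorner.exists_generator h𝔏br h𝔏irr hE'𝔏 hE'E' hfinR hfinK hno1U
  have hN₀sur := LeviCorner.surjOn_of_injOn hEN₀ (hfinK.trans hfinR.symm) hN₀inj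
  obtain ⟨ZN, hZN, hZNv, hZNP, hZNQ⟩ := hlift N₀ hN₀
  have hN₀N₀ : N₀ * N₀ = 0 := by rw [← hEN₀, mul_assoc, ← mul_assoc N₀ E' N₀, hN₀E, zero_mul, mul_zero]
  have hZNZN : ∀ p ∈ H.piece 1 0, ZN (ZN p) = 0 := fun p hp => by
    rw [hZNv ⟨p, hp⟩, hZNv (N₀ ⟨p, hp⟩), ← Module.End.mul_apply, hN₀N₀, LinearMap.zero_apply, Submodule.coe_zero]
  have hZNB : ∀ w, ZN (B w) = 0 := fun w => by
    have h1 : E' ⟨B w, hBim w⟩ = ⟨B w, hBim w⟩ := Subtype.ext (hEB w)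
    have h2 : N₀ ⟨B w, hBim w⟩ = 0 := by rw [← h1, ← Module.End.mul_apply, hN₀E, LinearMap.zero_apply]
    rw [hZNv ⟨B w, hBim w⟩, h2, Submodule.coe_zero]
  -- the compression `C′ = Z_N C Z_N ∈ 𝔥⁻`
  obtain ⟨hC', hC'Q, hC'im⟩ := NilCompression.compression_lowering_mem H ψ rfl heff hZN hZNP hZNQ hZNZN hC𝔊 hCQ hCim
  have hC'v : ∀ v, (ZN * C * ZN) v = ZN (C (ZN v)) := fun v => by rw [Module.End.mul_apply, Module.End.mul_apply]
  set C' := ZN * C * ZN with hC'def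
  -- `ψ_ℂ(C′·,·)` is non-degenerate on `U′ = ker E′`
  have hskZN : ∀ a b, ω (ZN a) b = -ω a (ZN b) := fun a b => by
    rw [hω]; exact formBaseChange_skew_of_mem_hodgeLieC ψ hZN a b
  set U' : Submodule ℂ (ℂ ⊗[ℚ] V) := (LinearMap.ker E').map (H.piece 1 0).subtype with hU'def
  have hU'3 : Module.finrank ℂ U' = 3 := by rw [hU'def, Submodule.finrank_map_subtype_eq, hfinK]
  have hrangeN₀ : ∀ w, ∃ x : ↥(H.piece 1 0), E' x = 0 ∧ ((N₀ x : ↥(H.piece 1 0)) : ℂ ⊗[ℚ] V) = B w := fun w => by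
    obtain ⟨x, hx, hxw⟩ := hN₀sur ⟨B w, hBim w⟩
    refine ⟨x, hx, ?_⟩
    rw [hxw, hE'v]
    exact hEB w
  have hnd' : ∀ u ∈ U', (∀ u' ∈ U', ω (C' u) u' = 0) → u = 0 := by
    rintro _ ⟨x, hx, rfl⟩ hu
    have hxE : E' x = 0 := LinearMap.mem_ker.1 hx
    have hiso : ∀ u'' ∈ LinearMap.range B, ω (C ((N₀ x : ↥(H.piece 1 0)) : ℂ ⊗[ℚ] V)) u'' = 0 := by
      rintro _ ⟨w, rfl⟩
      obtain ⟨x', hx', hx'w⟩ := hrangeN₀ w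
      have h := hu ((x' : ↥(H.piece 1 0)) : ℂ ⊗[ℚ] V) ⟨x', LinearMap.mem_ker.2 hx', rfl⟩
      simp only [Submodule.coe_subtype] at h
      rw [hC'v, hskZN, hZNv x, hZNv x', hx'w, neg_eq_zero] at h
      exact h
    have hN₀x : ((N₀ x : ↥(H.piece 1 0)) : ℂ ⊗[ℚ] V) = 0 := by
      refine hnd _ ?_ hiso
      rw [← hEN₀, Module.End.mul_apply, hE'v]
      exact hErg _
    have hx0 : x = 0 := hN₀inj x hxE (Subtype.ext hN₀x)
    rw [hx0]
    rfl
  -- THIN LOWER CORNER (R1 with the transported form)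
  have hthinL : ∀ M ∈ 𝔏, E' * M = 0 → M * E' = M → Module.finrank ℂ (LinearMap.range M) ≤ 2 →
      Module.finrank ℂ (LinearMap.range M) ≤ 1 := by
    intro M hM hEM hME hk
    obtain ⟨Z, hZ, hZv, hZP, hZQ⟩ := hlift M hM
    have hMM : M * M = 0 := by rw [show M * M = M * E' * M by rw [hME], mul_assoc, hEM, mul_zero]
    have hZZ : ∀ p ∈ H.piece 1 0, Z (Z p) = 0 := fun p hp => by
      rw [hZv ⟨p, hp⟩, hZv (M ⟨p, hp⟩), ← Module.End.mul_apply, hMM, LinearMap.zero_apply, Submodule.coe_zero]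
    have hZU' : ∀ p ∈ H.piece 1 0, Z p ∈ U' := fun p hp => by
      rw [hZv ⟨p, hp⟩]
      exact ⟨M ⟨p, hp⟩, LinearMap.mem_ker.2 (by rw [← Module.End.mul_apply, hEM, LinearMap.zero_apply]), rfl⟩
    have hk' : Module.finrank ℂ ((H.piece 1 0).map Z) ≤ 2 := by rw [hfinZ hZv]; exact hk
    have h := WeightOnePeirce.corner_finrank_le_one H ψ rfl heff hmin (by omega) hC' hC'Q hC'im hU'3 hnd' hZ hZP hZQ
      hZZ hZU' hk'
    rwa [hfinZ hZv] at h
  -- the complementary idempotent `F′ = 1 − E′`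
  set F' : Module.End ℂ ↥(H.piece 1 0) := 1 - E' with hF'def
  have hF'v : ∀ p, F' p = p - E' p := fun p => by rw [hF'def, LinearMap.sub_apply, Module.End.one_apply]
  have hF'𝔏 : F' ∈ 𝔏 := by
    have h : F' = 1 + (-1 : ℂ) • E' := LinearMap.ext fun p => by
      rw [hF'v, LinearMap.add_apply, LinearMap.smul_apply, Module.End.one_apply]
      module
    rw [h]
    exact 𝔏.add_mem h𝔏one (𝔏.smul_mem _ hE'𝔏)
  have hE'E'v : ∀ p, E' (E' p) = E' p := fun p => by rw [← Module.End.mul_apply, hE'E']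
  have hF'F' : F' * F' = F' := LinearMap.ext fun p => by
    rw [Module.End.mul_apply, hF'v, hF'v, map_sub, hE'E'v, sub_self, sub_zero]
  have hkerF' : LinearMap.ker F' = LinearMap.range E' := by
    ext x
    rw [LinearMap.mem_ker, hF'v, sub_eq_zero]
    constructor
    · intro h; exact ⟨x, h.symm⟩
    · rintro ⟨y, rfl⟩; rw [← Module.End.mul_apply, hE'E']
  have hrangeF' : LinearMap.range F' = LinearMap.ker E' := by
    ext x
    rw [LinearMap.mem_ker]
    constructor
    · rintro ⟨y, rfl⟩
      rw [hF'v, map_sub, ← Module.End.mul_apply, hE'E', sub_self]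
    · intro h; exact ⟨x, by rw [hF'v, h, sub_zero]⟩
  have hF'r : Module.finrank ℂ (LinearMap.range F') = 3 := by rw [hrangeF', hfinK]
  have hF'k : Module.finrank ℂ (LinearMap.ker F') = 3 := by rw [hkerF', hfinR]
  have hconv1 : ∀ M : Module.End ℂ ↥(H.piece 1 0), F' * M = M ↔ E' * M = 0 := fun M => by
    constructor
    · intro h
      refine LinearMap.ext fun p => ?_
      have hp := congrArg (fun X : Module.End ℂ ↥(H.piece 1 0) => X p) h
      simp only [Module.End.mul_apply, hF'v] at hp
      rw [Module.End.mul_apply, LinearMap.zero_apply]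
      exact sub_eq_self.1 hp
    · intro h
      refine LinearMap.ext fun p => ?_
      have hp := congrArg (fun X : Module.End ℂ ↥(H.piece 1 0) => X p) h
      simp only [Module.End.mul_apply, LinearMap.zero_apply] at hp
      rw [Module.End.mul_apply, hF'v, hp, sub_zero]
  have hconv2 : ∀ M : Module.End ℂ ↥(H.piece 1 0), M * F' = 0 ↔ M * E' = M := fun M => by
    constructor
    · intro h
      refine LinearMap.ext fun p => ?_
      have hp := congrArg (fun X : Module.End ℂ ↥(H.piece 1 0) => X p) h
      simp only [Module.End.mul_apply, hF'v, map_sub, LinearMap.zero_apply, sub_eq_zero] at hp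
      rw [Module.End.mul_apply]
      exact hp.symm
    · intro h
      refine LinearMap.ext fun p => ?_
      have hp := congrArg (fun X : Module.End ℂ ↥(H.piece 1 0) => X p) h
      simp only [Module.End.mul_apply] at hp
      rw [Module.End.mul_apply, hF'v, map_sub, hp, sub_self, LinearMap.zero_apply]
  have hthinL' : ∀ N ∈ 𝔏, F' * N = N → N * F' = 0 → Module.finrank ℂ (LinearMap.range N) ≤ 2 →
      Module.finrank ℂ (LinearMap.range N) ≤ 1 := fun N hN h1 h2 hk =>
    hthinL N hN ((hconv1 N).1 h1) ((hconv2 N).1 h2) hk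
  have hno1L : ∀ N ∈ 𝔏, F' * N = N → N * F' = 0 → Module.finrank ℂ (LinearMap.range N) ≤ 2 → N = 0 :=
    hno1 F' hF'𝔏 hF'F' (by omega) (by omega) hthinL'
  -- the lower corner line `ℂM₀` (R3 for `F′`) and the Levi lift `Z_M`
  obtain ⟨M₀, hM₀, hFM₀, hM₀F, hM₀0, hM₀inj, hM₀line⟩ :=
    LeviCorner.exists_generator h𝔏br h𝔏irr hF'𝔏 hF'F' hF'r hF'k hno1L
  have hEM₀ : E' * M₀ = 0 := (hconv1 M₀).1 hFM₀
  have hM₀E : M₀ * E' = M₀ := (hconv2 M₀).1 hM₀F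
  have hM₀sur := LeviCorner.surjOn_of_injOn hFM₀ (hF'k.trans hF'r.symm) hM₀inj
  have hM₀inj' : ∀ x : ↥(H.piece 1 0), E' x = x → M₀ x = 0 → x = 0 := fun x hx hMx =>
    hM₀inj x (by rw [hF'v, hx, sub_self]) hMx
  obtain ⟨ZM, hZM, hZMv, hZMP, hZMQ⟩ := hlift M₀ hM₀
  have hM₀M₀ : M₀ * M₀ = 0 := by rw [show M₀ * M₀ = M₀ * E' * M₀ by rw [hM₀E], mul_assoc, hEM₀, mul_zero]
  have hZMZM : ∀ p ∈ H.piece 1 0, ZM (ZM p) = 0 := fun p hp => by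
    rw [hZMv ⟨p, hp⟩, hZMv (M₀ ⟨p, hp⟩), ← Module.End.mul_apply, hM₀M₀, LinearMap.zero_apply, Submodule.coe_zero]
  have hskZM : ∀ a b, ω (ZM a) b = -ω a (ZM b) := fun a b => by
    rw [hω]; exact formBaseChange_skew_of_mem_hodgeLieC ψ hZM a b
  have hEZM : ∀ p ∈ H.piece 1 0, E (ZM p) = 0 := fun p hp => by
    rw [hZMv ⟨p, hp⟩, ← hE'v, ← Module.End.mul_apply, hEM₀, LinearMap.zero_apply, Submodule.coe_zero]
  have hCZM : ∀ p ∈ H.piece 1 0, C (ZM p) = 0 := fun p hp => hEker _ (hEZM p hp)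
  -- the compression `B′ = Z_M B Z_M ∈ 𝔥⁺`
  have hZMsq := NilCompression.sq_eq_zero_of_levi H ψ rfl heff hZM hZMP hZMQ hZMZM
  have hB' : ZM * B * ZM ∈ H.hodgeLieC := NilCompression.mul_mul_mul_mem hbrC hZM hZMsq hB
  set B' := ZM * B * ZM with hB'def
  have hB'v : ∀ v, B' v = ZM (B (ZM v)) := fun v => by rw [hB'def, Module.End.mul_apply, Module.End.mul_apply]
  have hB'P : ∀ p ∈ H.piece 1 0, B' p = 0 := fun p hp => by rw [hB'v, hBP _ (hZMP p hp), map_zero]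
  have hB'im : ∀ v, B' v ∈ H.piece 1 0 := fun v => by rw [hB'v]; exact hZMP _ (hBim _)
  -- corner lines in the form needed by the skeleton decompositions
  have hupperE : ∀ N ∈ 𝔏, E' * N = N → N * E' = 0 → ∃ c : ℂ, N = c • N₀ := hN₀line
  have hlowerE : ∀ M ∈ 𝔏, E' * M = 0 → M * E' = M → ∃ c : ℂ, M = c • M₀ := fun M hM h1 h2 =>
    hM₀line M hM ((hconv1 M).2 h1) ((hconv2 M).2 h2)
  have hupperF : ∀ N ∈ 𝔏, F' * N = N → N * F' = 0 → ∃ c : ℂ, N = c • M₀ := hM₀line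
  have hlowerF : ∀ M ∈ 𝔏, F' * M = 0 → M * F' = M → ∃ c : ℂ, M = c • N₀ := fun M hM h1 h2 => by
    refine hN₀line M hM ?_ ?_
    · refine LinearMap.ext fun p => ?_
      have hp := congrArg (fun X : Module.End ℂ ↥(H.piece 1 0) => X p) h1
      simp only [Module.End.mul_apply, hF'v, LinearMap.zero_apply, sub_eq_zero] at hp
      rw [Module.End.mul_apply]
      exact hp.symm
    · refine LinearMap.ext fun p => ?_
      have hp := congrArg (fun X : Module.End ℂ ↥(H.piece 1 0) => X p) h2
      simp only [Module.End.mul_apply, hF'v, map_sub] at hp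
      rw [Module.End.mul_apply, LinearMap.zero_apply]
      exact sub_eq_self.1 hp
  have hM₀F'0 : M₀ * F' = 0 := hM₀F
  have hN₀F' : N₀ * F' = N₀ := LinearMap.ext fun p => by
    rw [Module.End.mul_apply, hF'v, map_sub, ← Module.End.mul_apply (f := N₀) (g := E'), hN₀E, LinearMap.zero_apply,
      sub_zero]
  -- the eigenvector `u` of `N₀M₀` in `range E′` and `m = M₀u`
  obtain ⟨u₀, hEu₀, hu₀0, g, hg0, hgu⟩ :=
    LeviCorner.exists_eigenvector_mul hE'E' hEN₀ hEM₀ (by omega) hN₀inj hM₀inj'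
  set u : ℂ ⊗[ℚ] V := (u₀ : ℂ ⊗[ℚ] V) with hudef
  set m : ℂ ⊗[ℚ] V := ((M₀ u₀ : ↥(H.piece 1 0)) : ℂ ⊗[ℚ] V) with hmdef
  have huP : u ∈ H.piece 1 0 := u₀.2
  have hmP : m ∈ H.piece 1 0 := (M₀ u₀).2
  have hEu : E u = u := by rw [hudef, ← hE'v, hEu₀]
  have hu0 : u ≠ 0 := fun h => hu₀0 (Subtype.ext h)
  have hZMu : ZM u = m := hZMv u₀
  have hZNm : ZN m = g • u := by rw [hmdef, hZNv, hgu, Submodule.coe_smul]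
  have hZNu : ZN u = 0 := by
    rw [hudef, hZNv, ← hEu₀, ← Module.End.mul_apply, hN₀E, LinearMap.zero_apply, Submodule.coe_zero]
  have hZMm : ZM m = 0 := by
    rw [hmdef, hZMv, ← Module.End.mul_apply, hM₀M₀, LinearMap.zero_apply, Submodule.coe_zero]
  have hF'M₀u : F' (M₀ u₀) = M₀ u₀ := by
    rw [← Module.End.mul_apply, (hconv1 M₀).2 hEM₀]
  have hF'u₀ : F' u₀ = 0 := by rw [hF'v, hEu₀, sub_self]
  have hEm : E ((M₀ u₀ : ↥(H.piece 1 0)) : ℂ ⊗[ℚ] V) = 0 := by rw [← hZMv]; exact hEZM u huP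
  have hCM₀ : ∀ y : ↥(H.piece 1 0), C ((M₀ y : ↥(H.piece 1 0)) : ℂ ⊗[ℚ] V) = 0 := fun y =>
    hEker _ (by rw [← hZMv]; exact hEZM _ y.2)
  have hBCu : B (C u) = t • u := hEfix u hEu
  -- SKELETON DECOMPOSITIONS for the products `xC`, `xC′`, `Bz`, `B′z`
  have hdecA : ∀ x ∈ H.hodgeLieC, (∀ p ∈ H.piece 1 0, x p = 0) → (∀ v, x v ∈ H.piece 1 0) →
      ∃ l b : ℂ, ∀ p : ↥(H.piece 1 0), x (C (p : ℂ ⊗[ℚ] V)) = l • E p + b • ((M₀ p : ↥(H.piece 1 0)) : ℂ ⊗[ℚ] V) := by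
    intro x hx hxP hxim
    have hYP : ∀ p ∈ H.piece 1 0, (x * C) p ∈ H.piece 1 0 := fun p _ => by rw [Module.End.mul_apply]; exact hxim _
    have hY𝔏 : (x * C).restrict hYP ∈ 𝔏 := hrestr hYP ⟨x * C - C * x, hbrC x hx C hC𝔊, fun p hp => by
      simp only [LinearMap.sub_apply, Module.End.mul_apply, hxP p hp, map_zero, sub_zero]⟩
    have hYE : (x * C).restrict hYP * E' = (x * C).restrict hYP := LinearMap.ext fun p => Subtype.ext (by
      rw [Module.End.mul_apply]
      simp only [LinearMap.coe_restrict_apply, Module.End.mul_apply]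
      rw [hE'v, hCE])
    obtain ⟨l, b, hlb⟩ := LeviCorner.eq_smul_add_smul_of_mul_idem h𝔏br hE'𝔏 hE'E' hN₀ hN₀E hupperE hN₀sur hlowerE hY𝔏 hYE
    refine ⟨l, b, fun p => ?_⟩
    have h := congrArg (fun X : Module.End ℂ ↥(H.piece 1 0) => ((X p : ↥(H.piece 1 0)) : ℂ ⊗[ℚ] V)) hlb
    simp only [LinearMap.coe_restrict_apply, Module.End.mul_apply, LinearMap.add_apply, LinearMap.smul_apply,
      Submodule.coe_add, Submodule.coe_smul, hE'v] at h
    exact h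
  have hdecA' : ∀ x ∈ H.hodgeLieC, (∀ p ∈ H.piece 1 0, x p = 0) → (∀ v, x v ∈ H.piece 1 0) →
      ∃ l b : ℂ, ∀ p : ↥(H.piece 1 0), x (C' (p : ℂ ⊗[ℚ] V)) = l • ((F' p : ↥(H.piece 1 0)) : ℂ ⊗[ℚ] V) + b • ((N₀ p : ↥(H.piece 1 0)) : ℂ ⊗[ℚ] V) := by
    intro x hx hxP hxim
    have hYP : ∀ p ∈ H.piece 1 0, (x * C') p ∈ H.piece 1 0 := fun p _ => by rw [Module.End.mul_apply]; exact hxim _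
    have hY𝔏 : (x * C').restrict hYP ∈ 𝔏 := hrestr hYP ⟨x * C' - C' * x, hbrC x hx C' hC', fun p hp => by
      simp only [LinearMap.sub_apply, Module.End.mul_apply, hxP p hp, map_zero, sub_zero]⟩
    have hYE0 : ∀ p, (x * C').restrict hYP (E' p) = 0 := fun p => Subtype.ext (by
      rw [Submodule.coe_zero]
      simp only [LinearMap.coe_restrict_apply]
      rw [hE'v, Module.End.mul_apply, hC'v, hEv, map_smul, hZNB, smul_zero, map_zero, map_zero, map_zero])
    have hYE : (x * C').restrict hYP * F' = (x * C').restrict hYP := LinearMap.ext fun p => by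
      rw [Module.End.mul_apply, hF'v, map_sub, hYE0, sub_zero]
    obtain ⟨l, b, hlb⟩ := LeviCorner.eq_smul_add_smul_of_mul_idem h𝔏br hF'𝔏 hF'F' hM₀ hM₀F'0 hupperF hM₀sur hlowerF
      hY𝔏 hYE
    refine ⟨l, b, fun p => ?_⟩
    have h := congrArg (fun X : Module.End ℂ ↥(H.piece 1 0) => ((X p : ↥(H.piece 1 0)) : ℂ ⊗[ℚ] V)) hlb
    simp only [LinearMap.coe_restrict_apply, Module.End.mul_apply, LinearMap.add_apply, LinearMap.smul_apply,
      Submodule.coe_add, Submodule.coe_smul] at h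
    exact h
  have hdecB : ∀ z ∈ H.hodgeLieC, (∀ q ∈ H.piece 0 1, z q = 0) → (∀ v, z v ∈ H.piece 0 1) →
      ∃ l a : ℂ, ∀ p : ↥(H.piece 1 0), B (z (p : ℂ ⊗[ℚ] V)) = l • E p + a • ((N₀ p : ↥(H.piece 1 0)) : ℂ ⊗[ℚ] V) := by
    intro z hz hzQ hzim
    have hYP : ∀ p ∈ H.piece 1 0, (B * z) p ∈ H.piece 1 0 := fun p _ => by rw [Module.End.mul_apply]; exact hBim _
    have hY𝔏 : (B * z).restrict hYP ∈ 𝔏 := hrestr hYP ⟨B * z - z * B, hbrC B hB z hz, fun p hp => by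
      simp only [LinearMap.sub_apply, Module.End.mul_apply, hBP p hp, map_zero, sub_zero]⟩
    have hEY : E' * (B * z).restrict hYP = (B * z).restrict hYP := LinearMap.ext fun p => Subtype.ext (by
      rw [Module.End.mul_apply, hE'v]
      simp only [LinearMap.coe_restrict_apply, Module.End.mul_apply]
      exact hEB _)
    obtain ⟨l, a, hla⟩ := LeviCorner.eq_smul_add_smul_of_idem_mul h𝔏br hE'𝔏 hE'E' hN₀ hEN₀ hN₀E hupperE hN₀sur hY𝔏 hEY
    refine ⟨l, a, fun p => ?_⟩
    have h := congrArg (fun X : Module.End ℂ ↥(H.piece 1 0) => ((X p : ↥(H.piece 1 0)) : ℂ ⊗[ℚ] V)) hla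
    simp only [LinearMap.coe_restrict_apply, Module.End.mul_apply, LinearMap.add_apply, LinearMap.smul_apply,
      Submodule.coe_add, Submodule.coe_smul, hE'v] at h
    exact h
  have hdecB' : ∀ z ∈ H.hodgeLieC, (∀ q ∈ H.piece 0 1, z q = 0) → (∀ v, z v ∈ H.piece 0 1) →
      ∃ l a : ℂ, ∀ p : ↥(H.piece 1 0), B' (z (p : ℂ ⊗[ℚ] V)) = l • ((F' p : ↥(H.piece 1 0)) : ℂ ⊗[ℚ] V) + a • ((M₀ p : ↥(H.piece 1 0)) : ℂ ⊗[ℚ] V) := by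
    intro z hz hzQ hzim
    have hYP : ∀ p ∈ H.piece 1 0, (B' * z) p ∈ H.piece 1 0 := fun p _ => by rw [Module.End.mul_apply]; exact hB'im _
    have hY𝔏 : (B' * z).restrict hYP ∈ 𝔏 := hrestr hYP ⟨B' * z - z * B', hbrC B' hB' z hz, fun p hp => by
      simp only [LinearMap.sub_apply, Module.End.mul_apply, hB'P p hp, map_zero, sub_zero]⟩
    have hEY0 : ∀ p, E' ((B' * z).restrict hYP p) = 0 := fun p => Subtype.ext (by
      rw [hE'v, Submodule.coe_zero]
      simp only [LinearMap.coe_restrict_apply, Module.End.mul_apply]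
      rw [hB'v]
      exact hEZM _ (hBim _))
    have hEY : F' * (B' * z).restrict hYP = (B' * z).restrict hYP := LinearMap.ext fun p => by
      rw [Module.End.mul_apply, hF'v, hEY0, sub_zero]
    obtain ⟨l, a, hla⟩ := LeviCorner.eq_smul_add_smul_of_idem_mul h𝔏br hF'𝔏 hF'F' hM₀ hFM₀ hM₀F'0 hupperF hM₀sur hY𝔏 hEY
    refine ⟨l, a, fun p => ?_⟩
    have h := congrArg (fun X : Module.End ℂ ↥(H.piece 1 0) => ((X p : ↥(H.piece 1 0)) : ℂ ⊗[ℚ] V)) hla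
    simp only [LinearMap.coe_restrict_apply, Module.End.mul_apply, LinearMap.add_apply, LinearMap.smul_apply,
      Submodule.coe_add, Submodule.coe_smul] at h
    exact h
  -- INJECTIVITY: `q ∈ H.piece 0 1`, `Bq = 0`, `B′q = 0` ⟹ `q = 0`
  have hPdec : ∀ p ∈ H.piece 1 0, ∃ w : ℂ ⊗[ℚ] V, ∃ x : ↥(H.piece 1 0), p = E p + ZM x ∧ E p = B w := by
    intro p hp
    obtain ⟨x, -, hx⟩ := hM₀sur ⟨p, hp⟩
    refine ⟨t⁻¹ • C p, x, ?_, by rw [map_smul, hEv]⟩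
    have h : ((M₀ x : ↥(H.piece 1 0)) : ℂ ⊗[ℚ] V) = p - E p := by
      rw [hx, hF'v, Submodule.coe_sub, hE'v]
    rw [hZMv x, h, add_sub_cancel]
  have hinjQ : ∀ q ∈ H.piece 0 1, B q = 0 → B' q = 0 → q = 0 := by
    intro q hq hBq hB'q
    -- (a) `B (Z_M q) = 0`
    have ha : B (ZM q) = 0 := by
      have h1 : ZM (B (ZM q)) = 0 := by rw [← hB'v, hB'q]
      have h2 : M₀ ⟨B (ZM q), hBim _⟩ = 0 := Subtype.ext (by rw [← hZMv, Submodule.coe_zero]; exact h1)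
      have h3 := hM₀inj' ⟨B (ZM q), hBim _⟩ (Subtype.ext (by rw [hE'v]; exact hEB _)) h2
      exact congrArg Subtype.val h3
    -- (b) `Z_M q = 0`
    have hb : ZM q = 0 := by
      refine hωnd.1 _ fun w => ?_
      rw [← hvdec w, map_add, hQQ _ (hZMQ q hq) _ (hQmem w), add_zero]
      obtain ⟨w₁, x, hpx, hEw₁⟩ := hPdec _ (hPmem w)
      have t1 : ω (ZM q) (B w₁) = 0 := by
        rw [← neg_neg (ω (ZM q) (B w₁)), ← hskB, ha, map_zero, LinearMap.zero_apply, neg_zero]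
      have t2 : ω (ZM q) (ZM (x : ℂ ⊗[ℚ] V)) = 0 := by
        rw [hskZM, hZMZM _ x.2, map_zero, neg_zero]
      rw [hpx, map_add, hEw₁, t1, t2, add_zero]
    refine hωnd.1 _ fun w => ?_
    rw [← hvdec w, map_add, hQQ _ hq _ (hQmem w), add_zero]
    obtain ⟨w₁, x, hpx, hEw₁⟩ := hPdec _ (hPmem w)
    have t3 : ω q (B w₁) = 0 := by
      rw [← neg_neg (ω q (B w₁)), ← hskB, hBq, map_zero, LinearMap.zero_apply, neg_zero]
    have t4 : ω q (ZM (x : ℂ ⊗[ℚ] V)) = 0 := by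
      rw [← neg_neg (ω q (ZM (x : ℂ ⊗[ℚ] V))), ← hskZM, hb, map_zero, LinearMap.zero_apply, neg_zero]
    rw [hpx, map_add, hEw₁, t3, t4, add_zero]
  -- the SIX VALUES
  have hv4 : B' (C u) = 0 := by
    have h : ZM (C u) = 0 := by
      refine hωnd.1 _ fun w => ?_
      rw [← hvdec w, map_add, hQQ _ (hZMQ _ (hCim u)) _ (hQmem w), add_zero, hskZM]
      have e : ZM ((2 : ℂ)⁻¹ • (w + Θ w)) =
          ((M₀ ⟨(2 : ℂ)⁻¹ • (w + Θ w), hPmem w⟩ : ↥(H.piece 1 0)) : ℂ ⊗[ℚ] V) := hZMv ⟨_, hPmem w⟩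
      rw [e, hω, WeightOnePeirce.form_lowering_symm H ψ rfl hC𝔊, hCM₀, map_zero, LinearMap.zero_apply, neg_zero]
    rw [hB'v, h, map_zero, map_zero]
  have hv5 : ∀ q, B (ZN q) = 0 := fun q => by
    refine hωnd.1 _ fun w => ?_
    rw [hskB, hskZN, hZNB, neg_neg, map_zero]
  have hC'm : C' m = g • ZN (C u) := by rw [hC'v, hZNm, map_smul, map_smul]
  have hZNCu : ZN (C u) ≠ 0 := by
    intro h0
    apply hu0
    refine hnd u (by rw [← hEu]; exact hErg u) ?_
    rintro _ ⟨w, rfl⟩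
    obtain ⟨x', -, hx'w⟩ := hrangeN₀ w
    have h := congrArg (fun v => ω v ((x' : ↥(H.piece 1 0)) : ℂ ⊗[ℚ] V)) h0
    simp only [LinearMap.zero_apply, map_zero, hskZN, hZNv x', hx'w, neg_eq_zero] at h
    exact h
  obtain ⟨μ₀, c₀, hμc⟩ := hdecB' C' hC' hC'Q hC'im
  have hv6 : B' (C' m) = μ₀ • m := by
    have h := hμc (M₀ u₀)
    rw [hF'M₀u, ← Module.End.mul_apply (f := M₀) (g := M₀), hM₀M₀, LinearMap.zero_apply, Submodule.coe_zero, smul_zero,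
      add_zero] at h
    exact h
  have hμ₀ : μ₀ ≠ 0 := by
    intro h0
    rw [h0, zero_smul] at hv6
    have hC'm0 : C' m = 0 := hinjQ _ (hC'im m) (by rw [hC'v]; exact hv5 _) hv6
    rw [hC'm, smul_eq_zero] at hC'm0
    rcases hC'm0 with h | h
    · exact hg0 h
    · exact hZNCu h
  -- `Y = ℂ·Cu + ℂ·C′m`: every `q ∈ H.piece 0 1` with `Bq ∈ ℂu`, `B′q ∈ ℂm` lies in `Y`
  have hspanY : ∀ q ∈ H.piece 0 1, ∀ α β : ℂ, B q = α • u → B' q = β • m →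
      q ∈ Submodule.span ℂ ({C u, C' m} : Set (ℂ ⊗[ℚ] V)) := by
    intro q hq α β hBq hB'q
    have hmem : q - (α * t⁻¹) • C u - (β * μ₀⁻¹) • C' m = 0 := by
      refine hinjQ _ (Submodule.sub_mem _ (Submodule.sub_mem _ hq (Submodule.smul_mem _ _ (hCim u)))
        (Submodule.smul_mem _ _ (hC'im m))) ?_ ?_
      · rw [map_sub, map_sub, map_smul, map_smul, hBq, hBCu, hC'v, hv5, smul_zero, sub_zero, smul_smul, mul_assoc,
          inv_mul_cancel₀ ht, mul_one, sub_self]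
      · rw [map_sub, map_sub, map_smul, map_smul, hB'q, hv4, hv6, smul_zero, sub_zero, smul_smul, mul_assoc,
          inv_mul_cancel₀ hμ₀, mul_one, sub_self]
    rw [sub_sub, sub_eq_zero] at hmem
    rw [hmem]
    exact Submodule.add_mem _ (Submodule.smul_mem _ _ (Submodule.subset_span (by simp)))
      (Submodule.smul_mem _ _ (Submodule.subset_span (by simp)))
  -- THE INVARIANT PLANE `X = ℂu + ℂm`
  set X : Submodule ℂ (ℂ ⊗[ℚ] V) := Submodule.span ℂ ({u, m} : Set (ℂ ⊗[ℚ] V)) with hXdef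
  have huX : u ∈ X := Submodule.subset_span (by simp)
  have hmX : m ∈ X := Submodule.subset_span (by simp)
  have hgen : ∀ x ∈ H.hodgeLieC, ∀ z ∈ H.hodgeLieC, (∀ p ∈ H.piece 1 0, x p = 0) → (∀ v, x v ∈ H.piece 1 0) → (∀ q ∈ H.piece 0 1, z q = 0) →
      (∀ v, z v ∈ H.piece 0 1) → (x * z - z * x) u ∈ X ∧ (x * z - z * x) m ∈ X := by
    intro x hx z hz hxP hxim hzQ hzim
    obtain ⟨l, b, hlb⟩ := hdecA x hx hxP hxim
    obtain ⟨l', b', hlb'⟩ := hdecA' x hx hxP hxim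
    have hxCu : x (C u) ∈ X := by
      rw [show x (C u) = _ from hlb u₀, show E (u₀ : ℂ ⊗[ℚ] V) = u from hEu]
      exact Submodule.add_mem _ (Submodule.smul_mem _ _ huX) (Submodule.smul_mem _ _ hmX)
    have hxC'm : x (C' m) ∈ X := by
      rw [show x (C' m) = _ from hlb' (M₀ u₀), hF'M₀u, hgu, Submodule.coe_smul]
      exact Submodule.add_mem _ (Submodule.smul_mem _ _ hmX) (Submodule.smul_mem _ _ (Submodule.smul_mem _ _ huX))
    have hxY : ∀ q ∈ Submodule.span ℂ ({C u, C' m} : Set (ℂ ⊗[ℚ] V)), x q ∈ X := by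
      intro q hq
      obtain ⟨c, d, rfl⟩ := Submodule.mem_span_pair.1 hq
      rw [map_add, map_smul, map_smul]
      exact Submodule.add_mem _ (Submodule.smul_mem _ _ hxCu) (Submodule.smul_mem _ _ hxC'm)
    obtain ⟨lz, az, hz1⟩ := hdecB z hz hzQ hzim
    obtain ⟨lz', az', hz2⟩ := hdecB' z hz hzQ hzim
    have hN₀u₀ : N₀ u₀ = 0 := by
      rw [← hEu₀]
      rw [← Module.End.mul_apply, hN₀E, LinearMap.zero_apply]
    have hM₀M₀u : M₀ (M₀ u₀) = 0 := by rw [← Module.End.mul_apply, hM₀M₀, LinearMap.zero_apply]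
    have hzu : z u ∈ Submodule.span ℂ ({C u, C' m} : Set (ℂ ⊗[ℚ] V)) := by
      refine hspanY _ (hzim u) lz az' ?_ ?_
      · rw [show B (z u) = _ from hz1 u₀, show E (u₀ : ℂ ⊗[ℚ] V) = u from hEu, hN₀u₀, Submodule.coe_zero, smul_zero,
          add_zero]
      · rw [show B' (z u) = _ from hz2 u₀, hF'u₀, Submodule.coe_zero, smul_zero, zero_add]
    have hzm : z m ∈ Submodule.span ℂ ({C u, C' m} : Set (ℂ ⊗[ℚ] V)) := by
      refine hspanY _ (hzim m) (az * g) lz' ?_ ?_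
      · rw [show B (z m) = _ from hz1 (M₀ u₀), hgu, Submodule.coe_smul, hEm, smul_zero, zero_add, smul_smul]
      · rw [show B' (z m) = _ from hz2 (M₀ u₀), hF'M₀u, hM₀M₀u, Submodule.coe_zero, smul_zero, add_zero]
    refine ⟨?_, ?_⟩
    · rw [LinearMap.sub_apply, Module.End.mul_apply, Module.End.mul_apply, hxP u huP, map_zero, sub_zero]
      exact hxY _ hzu
    · rw [LinearMap.sub_apply, Module.End.mul_apply, Module.End.mul_apply, hxP m hmP, map_zero, sub_zero]
      exact hxY _ hzm
  -- every Levi element preserves `X` (N15)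
  have hspanX : ∀ W ∈ Submodule.span ℂ {W : Module.End ℂ (ℂ ⊗[ℚ] V) | ∃ x ∈ H.hodgeLieC, ∃ z ∈ H.hodgeLieC,
      (∀ p ∈ H.piece 1 0, x p = 0) ∧ (∀ v, x v ∈ H.piece 1 0) ∧ (∀ q ∈ H.piece 0 1, z q = 0) ∧
      (∀ v, z v ∈ H.piece 0 1) ∧ W = x * z - z * x}, W u ∈ X ∧ W m ∈ X := by
    intro W hW
    induction hW using Submodule.span_induction with
    | mem W hW =>
      obtain ⟨x, hx, z, hz, hxP, hxim, hzQ, hzim, rfl⟩ := hW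
      exact hgen x hx z hz hxP hxim hzQ hzim
    | zero => exact ⟨by rw [LinearMap.zero_apply]; exact X.zero_mem, by rw [LinearMap.zero_apply]; exact X.zero_mem⟩
    | add W W' _ _ h h' => exact ⟨by rw [LinearMap.add_apply]; exact X.add_mem h.1 h'.1,
        by rw [LinearMap.add_apply]; exact X.add_mem h.2 h'.2⟩
    | smul c W _ h => exact ⟨by rw [LinearMap.smul_apply]; exact X.smul_mem _ h.1,
        by rw [LinearMap.smul_apply]; exact X.smul_mem _ h.2⟩
  have hlevi : ∀ Z ∈ H.hodgeLieC, (∀ p ∈ H.piece 1 0, Z p ∈ H.piece 1 0) → (∀ q ∈ H.piece 0 1, Z q ∈ H.piece 0 1) →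
      Z u ∈ X ∧ Z m ∈ X := fun Z hZ hZP hZQ =>
    hspanX Z (levi_mem_span_bracket_of_simple H ψ rfl heff hsimple hB hB0 hBP hBim hZ hZP hZQ)
  -- `X ∩ P` (as a subspace of `P`) is `𝔏`-stable, non-zero and proper: contradiction
  set X' : Submodule ℂ ↥(H.piece 1 0) := X.comap (H.piece 1 0).subtype with hX'def
  have hX'stab : ∀ A ∈ 𝔏, ∀ y ∈ X', A y ∈ X' := by
    intro A hA y hy
    obtain ⟨Z, hZ, hZv, hZP, hZQ⟩ := hlift A hA
    rw [hX'def, Submodule.mem_comap, Submodule.subtype_apply] at hy ⊢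
    obtain ⟨c, d, hcd⟩ := Submodule.mem_span_pair.1 hy
    obtain ⟨hZu, hZm⟩ := hlevi Z hZ hZP hZQ
    rw [← hZv y, ← hcd, map_add, map_smul, map_smul]
    exact X.add_mem (X.smul_mem _ hZu) (X.smul_mem _ hZm)
  rcases h𝔏irr X' hX'stab with h | h
  · have hu₀X : u₀ ∈ X' := by rw [hX'def, Submodule.mem_comap]; exact huX
    rw [h, Submodule.mem_bot] at hu₀X
    exact hu₀0 hu₀X
  · have hle : X'.map (H.piece 1 0).subtype ≤ X := by
      rintro _ ⟨y, hy, rfl⟩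
      exact hy
    have h1 : Module.finrank ℂ X' ≤ 2 := by
      rw [← Submodule.finrank_map_subtype_eq (H.piece 1 0) X']
      refine (Submodule.finrank_mono hle).trans ?_
      refine (finrank_span_le_card (R := ℂ) ({u, m} : Set (ℂ ⊗[ℚ] V))).trans ?_
      rw [Set.toFinset_insert, Set.toFinset_singleton]
      exact Finset.card_le_two
    rw [h, finrank_top] at h1
    have hP6' : Module.finrank ℂ ↥(H.piece 1 0) = 6 := hP6
    omega

/-! ## §3 `Hg = Sp₁₂` for `End_Hdg = ℚ`, `dim V = 12` -/

/-- **Rank twelve, `End_Hdg = ℚ`: every `ψ_ℂ`-skew operator lies in `Lie Hg ⊗ ℂ`** (`= 𝔰𝔭(V_ℂ, ψ_ℂ)`): the rank-twelve dispatch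
`rankTwelve_sp_or_simple_three` leaves a minimal raising tripotent of rank `3`, which `false_of_minimal_rank_three` excludes.
This is `RankTwelveTarget` of the cell's crux file. [cite: MoonenZarhin1999LowDim, §2 (2.3)–(2.5) and §3 (3.1)]
[cite: Ribet1983, Thm. 3] [cite: Deligne1982HodgeCycles, I §3] -/
theorem mem_hodgeLieC_of_skew_rankTwelve (H : HodgeStructure V n) (hn : n = 1) (heff : H.IsEffective)
    (ψ : H.Polarization) (hE : ∀ a ∈ H.endAlg, ∃ x : ℚ, a = x • (1 : Module.End ℚ V)) (hV : Module.finrank ℚ V = 12) :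
    ∀ Y : Module.End ℂ (ℂ ⊗[ℚ] V),
      (∀ x y, ψ.form.baseChange ℂ (Y x) y + ψ.form.baseChange ℂ x (Y y) = 0) → Y ∈ H.hodgeLieC := by
  rcases rankTwelve_sp_or_simple_three H hn heff ψ hE hV with
    h | ⟨⟨B, C, hB, hB0, hBP, hBim, hC, hmin, h3⟩, hsimple⟩
  · exact h
  · exact (WeightOnePeirce.false_of_minimal_rank_three H ψ hn heff hE hV hsimple hB hB0 hBP hBim hC hmin h3).elim

end HodgeStructure

end Literature.AlgebraicGeometry.Motives
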